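import Literature.MathematicalPhysics.QuantumLattice.HubbardTTPrimeMeanEnergyMinimisers
import Literature.MathematicalPhysics.QuantumLattice.CanonicalClassChemicalPotential
import HarnessLib

/-!
# Minimisers of the grand-canonical and pair-sourced `t–t'` Hubbard mean energy are ground states

Topic `Literature/MathematicalPhysics/QuantumLattice`; namespace
`Literature.MathematicalPhysics.QuantumLattice` (the file path). Companion of
`MeanEnergyMinimisersAreGroundStates.lean` (Bratteli–Kishimoto–Robinson Thm. 2, `2 ⇒ 1`, general even
finite-range interactions), `HubbardTTPrimeMeanEnergyMinimisers.lean` (the `t–t'` interaction) and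
`TIGroundEnergyDensityResponse.lean` / `CanonicalClassChemicalPotential.lean` (the `μ`-pencil
`Φ(t,t',U) − μ n`, the Koma–Tasaki pair source `P_g`, canonical-class minimisers). Everything is PROVED;
no named fact.

* the number interaction `n`, the pair source `P_g`, the `μ`-pencil and the sourced interaction
  `Φ(t,t',U) − μ n − h P_g` are TRANSLATION INVARIANT and of FINITE RANGE `1`;
* `IsMeanEnergyMinimiser.isGroundState_ttPrimeMu / _ttPrimeSourced`: translation-invariant minimisers of
  the mean energy of `Φ(t,t',U) − μ n` resp. `Φ(t,t',U) − μ n − h P_g` are ground states of that interaction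
  (BKR Thm. 2, `2 ⇒ 1`, for the cell's sourced model);
* `exists_isGroundState_pencil_number_of_canonical`: a translation-invariant state of density
  `n ∈ (0,2)` minimising `e_Ψ` at FIXED density (canonical class), `Ψ` even Hermitian translation
  invariant of finite range on `ℤ²`, is a ground state of `Ψ − μ n` for some chemical potential `μ`
  (Ruelle 1969 §3.4 + BKR Thm. 2) — the hypothesis `hgs` of `FermionGroundStatesMinimiseMeanEnergy` §3 and
  of the charged KKT rows, now discharged for every canonical-class minimiser.

## References

* [BratteliKishimotoRobinson1978] Commun. Math. Phys. 64 (1978) 41–48, Thm. 2.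
* [Ruelle1969] D. Ruelle, *Statistical Mechanics: Rigorous Results*, §3.4 (tangents to the convex
  energy; chemical potential of a canonical minimiser).
* [KomaTasaki1994] the pair source `−h(Δ + Δ†)`, §1.
* [ArakiMoriya2003] §1 (IV), §5.4, §8.
-/

noncomputable section

namespace Literature.MathematicalPhysics.QuantumLattice

open Matrix Finset HubbardWave0 Literature.Probability.LatticeModels
open scoped ComplexOrder

variable {d : ℕ}

/-! ### §1. The number interaction -/

/-- On-site term of `n` at a region `S = {y}`. [cite: ArakiMoriya2003, §5.1] -/
theorem numberInteraction_apply_of_eq_singleton {S : Finset (Site d)} {y : Site d} (hS : S = {y})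
    (hy : y ∈ S) : (numberInteraction d).Φ S = nAt y hy 0 + nAt y hy 1 := by
  subst hS
  exact numberInteraction_apply_singleton y

/-- **The number interaction is translation invariant.** [cite: ArakiMoriya2003, §1 assumption (IV)] -/
theorem numberInteraction_isTranslationInvariant : (numberInteraction d).IsTranslationInvariant := by
  intro v X
  by_cases h1 : ∃ x : Site d, X = {x}
  · obtain ⟨x, rfl⟩ := h1
    rw [numberInteraction_apply_of_eq_singleton (shiftSet_singleton_eq v x)
        (PolySite.add_mem_shiftSet v (Finset.mem_singleton_self x)),
      numberInteraction_apply_singleton, map_add, nAt, nAt, fermionEmbed_numberOp, fermionEmbed_numberOp,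
      PolySite.shiftEmb_pt]
  have hX : (numberInteraction d).Φ X = 0 := numberInteraction_apply_eq_zero fun x hx => h1 ⟨x, hx⟩
  have hS : (numberInteraction d).Φ (shiftSet v X) = 0 :=
    numberInteraction_apply_eq_zero fun y hy => h1 ⟨y - v, eq_singleton_of_shiftSet_eq hy⟩
  rw [hX, hS, map_zero]

/-! ### §2. The pair source -/

section PairSource

variable (g : Site 2 → ℝ)

/-- On-site term of `P_g` at a region `S = {y}`. [cite: KomaTasaki1994, §1] -/
theorem pairSourceInteraction_apply_of_eq_singleton {S : Finset (Site 2)} {y : Site 2} (hS : S = {y})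
    (hy : y ∈ S) :
    (pairSourceInteraction g).Φ S =
      ((g 0 / Real.sqrt 2 : ℝ) : ℂ) • (singletPairAt y y hy hy + (singletPairAt y y hy hy)ᴴ) := by
  subst hS
  exact pairSourceInteraction_apply_singleton g y

/-- Bond term of `P_g` at a region `S = {y, z}`, `z = y + e_i`. [cite: KomaTasaki1994, §1] -/
theorem pairSourceInteraction_apply_of_eq_pair {S : Finset (Site 2)} {y z : Site 2} {i : Fin 2}
    (hS : S = {y, z}) (hz : z = y + unitVec i) (hy : y ∈ S) (hz' : z ∈ S) :
    (pairSourceInteraction g).Φ S =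
      ((Real.sqrt 2 * g (unitVec i) : ℝ) : ℂ) • (singletPairAt y z hy hz' + (singletPairAt y z hy hz')ᴴ) := by
  subst hz; subst hS
  exact pairSourceInteraction_apply_pair g y i

/-- Translations act on singlet pair annihilators: `Γ(τ_v) b_{x,y} = b_{x+v,y+v}`.
[cite: ArakiMoriya2003, §4.1 Def. 4.3] -/
theorem fermionEmbed_shiftEmb_singletPairAt (v : Site d) {X : Finset (Site d)} (x y : Site d)
    (hx : x ∈ X) (hy : y ∈ X) :
    fermionEmbed (PolySite.shiftEmb v X) (singletPairAt x y hx hy) =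
      singletPairAt (x + v) (y + v) (PolySite.add_mem_shiftSet v hx) (PolySite.add_mem_shiftSet v hy) := by
  rw [singletPairAt, singletPairAt, map_sub, map_mul, map_mul, fermionEmbed_shiftEmb_cAt,
    fermionEmbed_shiftEmb_cAt, fermionEmbed_shiftEmb_cAt, fermionEmbed_shiftEmb_cAt]

/-- **The pair-source interaction is translation invariant.** [cite: ArakiMoriya2003, §1 assumption (IV)] -/
theorem pairSourceInteraction_isTranslationInvariant : (pairSourceInteraction g).IsTranslationInvariant := by
  intro v X
  by_cases h1 : ∃ x : Site 2, X = {x}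
  · obtain ⟨x, rfl⟩ := h1
    rw [pairSourceInteraction_apply_of_eq_singleton g (shiftSet_singleton_eq v x)
        (PolySite.add_mem_shiftSet v (Finset.mem_singleton_self x)),
      pairSourceInteraction_apply_singleton, map_smul, map_add, fermionEmbed_conjTranspose,
      fermionEmbed_shiftEmb_singletPairAt]
  by_cases h2 : ∃ (x : Site 2) (i : Fin 2), X = {x, x + unitVec i}
  · obtain ⟨x, i, rfl⟩ := h2
    rw [pairSourceInteraction_apply_of_eq_pair g (shiftSet_pair_eq v x (x + unitVec i))
        (add_right_comm x (unitVec i) v) (PolySite.add_mem_shiftSet v (Finset.mem_insert_self _ _))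
        (PolySite.add_mem_shiftSet v (Finset.mem_insert_of_mem (Finset.mem_singleton_self _))),
      pairSourceInteraction_apply_pair, map_smul, map_add, fermionEmbed_conjTranspose,
      fermionEmbed_shiftEmb_singletPairAt]
  have hX : (pairSourceInteraction g).Φ X = 0 :=
    pairSourceInteraction_apply_eq_zero g (fun x hx => h1 ⟨x, hx⟩) (fun x i hx => h2 ⟨x, i, hx⟩)
  have hS : (pairSourceInteraction g).Φ (shiftSet v X) = 0 := by
    refine pairSourceInteraction_apply_eq_zero g (fun y hy => h1 ⟨y - v, eq_singleton_of_shiftSet_eq hy⟩)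
      (fun y i hy => h2 ⟨y - v, i, ?_⟩)
    rw [eq_pair_of_shiftSet_eq hy, add_sub_right_comm]
  rw [hX, hS, map_zero]

/-- **The pair-source interaction has range `1`.** [cite: ArakiMoriya2003, §5.4] -/
theorem pairSourceInteraction_hasFiniteRange : (pairSourceInteraction g).HasFiniteRange 1 := by
  intro X hX
  refine pairSourceInteraction_apply_eq_zero g (fun x hx => ?_) (fun x i hx => ?_)
  · subst hx
    rw [Finset.coe_singleton, Metric.diam_singleton] at hX
    exact absurd hX (by norm_num)
  · subst hx
    rw [diam_coe_pair_add, norm_unitVec_site] at hX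
    exact absurd hX (lt_irrefl _)

end PairSource

/-! ### §3. The `μ`-pencil and the sourced interaction -/

/-- The `μ`-pencil `Φ(t,t',U) − μ n` is translation invariant. [cite: ArakiMoriya2003, §1 assumption (IV)] -/
theorem hubbardTTPrimeMuInteraction_isTranslationInvariant (t t' U μ : ℝ) :
    (hubbardTTPrimeMuInteraction t t' U μ).IsTranslationInvariant :=
  FermionInteraction.isTranslationInvariant_pencil (hubbardTTPrimeFermionInteraction_isTranslationInvariant t t' U)
    numberInteraction_isTranslationInvariant _

/-- The `μ`-pencil has range `1`. [cite: ArakiMoriya2003, §5.4] -/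
theorem hubbardTTPrimeMuInteraction_hasFiniteRange (t t' U μ : ℝ) :
    (hubbardTTPrimeMuInteraction t t' U μ).HasFiniteRange 1 :=
  FermionInteraction.hasFiniteRange_pencil (hubbardTTPrimeFermionInteraction_hasFiniteRange t t' U)
    (numberInteraction_hasFiniteRange 1 zero_le_one) _

/-- The sourced interaction `Φ(t,t',U) − μ n − h P_g` is translation invariant.
[cite: ArakiMoriya2003, §1 assumption (IV)] -/
theorem hubbardTTPrimeSourcedInteraction_isTranslationInvariant (t t' U μ : ℝ) (g : Site 2 → ℝ) (h : ℝ) :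
    (hubbardTTPrimeSourcedInteraction t t' U μ g h).IsTranslationInvariant :=
  FermionInteraction.isTranslationInvariant_pencil (hubbardTTPrimeMuInteraction_isTranslationInvariant t t' U μ)
    (pairSourceInteraction_isTranslationInvariant g) _

/-- The sourced interaction has range `1`. [cite: ArakiMoriya2003, §5.4] -/
theorem hubbardTTPrimeSourcedInteraction_hasFiniteRange (t t' U μ : ℝ) (g : Site 2 → ℝ) (h : ℝ) :
    (hubbardTTPrimeSourcedInteraction t t' U μ g h).HasFiniteRange 1 :=
  FermionInteraction.hasFiniteRange_pencil (hubbardTTPrimeMuInteraction_hasFiniteRange t t' U μ)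
    (pairSourceInteraction_hasFiniteRange g) _

/-! ### §4. Minimisers are ground states -/

namespace InfVolFermionState

/-- **`2 ⇒ 1` for the grand-canonical `t–t'` Hubbard interaction `Φ(t,t',U) − μ n`.**
[cite: BratteliKishimotoRobinson1978, Thm. 2] -/
theorem IsMeanEnergyMinimiser.isGroundState_ttPrimeMu {t t' U μ : ℝ} {ω : InfVolFermionState 2}
    (hmin : ω.IsMeanEnergyMinimiser (hubbardTTPrimeMuInteraction t t' U μ) 1) :
    ω.IsGroundState (hubbardTTPrimeMuInteraction t t' U μ) 1 :=
  hmin.isGroundState two_pos (hubbardTTPrimeMuInteraction_hasFiniteRange t t' U μ)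
    (hubbardTTPrimeMuInteraction_isHermitian t t' U μ) (hubbardTTPrimeMuInteraction_isEven t t' U μ)
    (hubbardTTPrimeMuInteraction_isTranslationInvariant t t' U μ)

/-- **`2 ⇒ 1` for the pair-sourced `t–t'` Hubbard interaction `Φ(t,t',U) − μ n − h P_g`** (Koma–Tasaki
source): every translation-invariant minimiser of its mean energy is a ground state of it — so all
ground-state rows (stationarity `ω([H, B]) = 0`, the Bratteli–Robinson inequality, the local
minimum-energy principle) hold for every such minimiser. [cite: BratteliKishimotoRobinson1978, Thm. 2] -/
theorem IsMeanEnergyMinimiser.isGroundState_ttPrimeSourced {t t' U μ : ℝ} {g : Site 2 → ℝ} {h : ℝ}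
    {ω : InfVolFermionState 2} (hmin : ω.IsMeanEnergyMinimiser (hubbardTTPrimeSourcedInteraction t t' U μ g h) 1) :
    ω.IsGroundState (hubbardTTPrimeSourcedInteraction t t' U μ g h) 1 :=
  hmin.isGroundState two_pos (hubbardTTPrimeSourcedInteraction_hasFiniteRange t t' U μ g h)
    (hubbardTTPrimeSourcedInteraction_isHermitian t t' U μ g h) (hubbardTTPrimeSourcedInteraction_isEven t t' U μ g h)
    (hubbardTTPrimeSourcedInteraction_isTranslationInvariant t t' U μ g h)

/-- **Canonical-class minimisers are ground states of `Ψ − μ n`.** Let `Ψ` be an even, Hermitian,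
translation-invariant interaction of finite range `R` on `ℤ²` and `ω` a translation-invariant state of
density `n ∈ (0, 2)` with `e_Ψ(ω) ≤ e_Ψ(σ)` for every translation-invariant `σ` of density `n`. Then for
some chemical potential `μ`, `ω` is a ground state of the `μ`-pencil `Ψ − μ n` (Ruelle 1969 §3.4: a
canonical minimiser minimises `e_Ψ − μρ` for a tangent slope `μ`, the tree's
`isMeanEnergyMinimiser_pencil_number_of_canonical`; then Bratteli–Kishimoto–Robinson Thm. 2, `2 ⇒ 1`).
[cite: BratteliKishimotoRobinson1978, Thm. 2] [cite: Ruelle1969, §3.4] -/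
theorem exists_isGroundState_pencil_number_of_canonical (Ψ : FermionInteraction 2) {R : ℝ} (hR0 : 0 ≤ R)
    (hR : Ψ.HasFiniteRange R) (hH : Ψ.IsHermitian) (hE : Ψ.IsEven) (hT : Ψ.IsTranslationInvariant)
    {ω : InfVolFermionState 2} (hω : ω.IsTranslationInvariant) {n : ℝ} (hρ : ω.density = n) (hn0 : 0 < n)
    (hn2 : n < 2)
    (hmin : ∀ σ : InfVolFermionState 2, σ.IsTranslationInvariant → σ.density = n →
      ω.meanEnergy Ψ R ≤ σ.meanEnergy Ψ R) :
    ∃ μ : ℝ, ω.IsGroundState (FermionInteraction.pencil Ψ (numberInteraction 2) (-μ)) R := by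
  obtain ⟨μ, hμ⟩ := isMeanEnergyMinimiser_pencil_number_of_canonical Ψ R hω hρ hn0 hn2 hmin
  refine ⟨μ, hμ.isGroundState two_pos (FermionInteraction.hasFiniteRange_pencil hR (numberInteraction_hasFiniteRange R hR0) _)
    (FermionInteraction.isHermitian_pencil hH numberInteraction_isHermitian _)
    (FermionInteraction.isEven_pencil hE numberInteraction_isEven _)
    (FermionInteraction.isTranslationInvariant_pencil hT numberInteraction_isTranslationInvariant _)⟩

/-- **Canonical-class minimisers of the pair-sourced `t–t'` model are ground states of
`Φ(t,t',U) − h P_g − μ n`** for some `μ`: the form consumed by the cell's KKT rows for the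
density-`n` minimisers of `E_{√2 g} = e^{tt'} − h e_P`. [cite: BratteliKishimotoRobinson1978, Thm. 2] [cite: Ruelle1969, §3.4] -/
theorem exists_isGroundState_pencil_number_of_canonical_ttPrimeSourced {t t' U : ℝ} {g : Site 2 → ℝ}
    {h : ℝ} {ω : InfVolFermionState 2} (hω : ω.IsTranslationInvariant) {n : ℝ} (hρ : ω.density = n)
    (hn0 : 0 < n) (hn2 : n < 2)
    (hmin : ∀ σ : InfVolFermionState 2, σ.IsTranslationInvariant → σ.density = n →
      ω.meanEnergy (hubbardTTPrimeSourcedInteraction t t' U 0 g h) 1 ≤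
        σ.meanEnergy (hubbardTTPrimeSourcedInteraction t t' U 0 g h) 1) :
    ∃ μ : ℝ, ω.IsGroundState
      (FermionInteraction.pencil (hubbardTTPrimeSourcedInteraction t t' U 0 g h) (numberInteraction 2) (-μ)) 1 :=
  exists_isGroundState_pencil_number_of_canonical _ zero_le_one (hubbardTTPrimeSourcedInteraction_hasFiniteRange t t' U 0 g h)
    (hubbardTTPrimeSourcedInteraction_isHermitian t t' U 0 g h) (hubbardTTPrimeSourcedInteraction_isEven t t' U 0 g h)
    (hubbardTTPrimeSourcedInteraction_isTranslationInvariant t t' U 0 g h) hω hρ hn0 hn2 hmin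

end InfVolFermionState

end Literature.MathematicalPhysics.QuantumLattice

end
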